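import Summits.Parity.BatemanHorn.Theorems.SoloInformedTrapezoidProfileCancellation
import Summits.Parity.BatemanHorn.Theorems.SoloInformedRootPairCorrelation

/-!
# The scale profile in second-moment and pair-correlation currency

Informed soloist `solo-Parity-informed` (session 144), conjunct `BatemanHorn`, the `d ≥ 3` rung BELOW the parity
wall.  The profile hypothesis `HooleyMeanProfile g θ η` of `SoloInformedHooleyMeanProfile` (an `o(E)` plus
`C·H·E^{1−η}` bound for the `ℓ¹`-mass of the dyadic root exponential sums `T(h) = ∑_{E<e≤E'} S_g(h;e)` over
`1 ≤ |h| ≤ H`) has a second-moment form and a pair-correlation form with the SAME scale structure: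

* `HooleyMeanSquareProfile g θ η`: `∑_{1≤h≤H} (|T(h)|² + |T(−h)|²) ≤ ε·E²/H + C·H·E^{2(1−η)}` for every `ε > 0`,
  `E ≥ E₀(ε)`, `E ≤ E' ≤ 2E`, `H ≤ E^θ` — a root-mean-square saving factor `≍ min(H, E^η)` per frequency;
* `HooleyPairCorrelationProfile g θ η`: for the Fejér pair sum of the root fractions `ν/e` at scale `1/H`
  (`rootPairSum`, `SoloInformedRootPairCorrelation`), `PS(H) ≤ N² + ε·E²/H + C·H·E^{2(1−η)}` for `H ≤ 2E^θ`.

By Cauchy–Schwarz `HooleyMeanSquareProfile g θ η → HooleyMeanProfile g θ η` (the `ε·E²/H`, with its `1/H`, is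
exactly what makes the `o(E)` of the `ℓ¹` profile come out; an `H`-free `ε·E²` would give only `√(εH)·E`), and by the
Fejér sandwich `∑_{1≤|h|≤H}|T(h)|² ≤ 2(PS(2H) − N²)` the pair form implies the second-moment form (constant `4C`)
and conversely for `H ≤ E^θ`.  Hence `erdosDivisorSumAsymptotic_of_meanSquareProfile` and
`erdosDivisorSumAsymptotic_cubic_of_pairCorrelationProfile`: for an irreducible cubic, if at every scale `1/H`,
`H ≤ 2E^θ` (some `θ > 2/3`), the Fejér-smoothed number of ordered pairs of root fractions to moduli `e ∈ (E, E']`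
within `≲ 1/H` of each other exceeds the uniform prediction `N²` by at most `o(E²/H) + C·H·E^{2(1−η)}` with some
`η > 1/3` (Poissonian points: excess `≍ N·H ≍ H·E`, i.e. `η = 1/2`), then `∑_{n≤x} τ(g(n)) ~ 3·A_g·x log x`.  At
`H = 2` the pair hypothesis is `|T(1)|² = o(E²)` — Hooley's qualitative equidistribution; the local (non-profile)
hypotheses `HooleyMeanSquareLocal`, `HooleyPairCorrelationLocal` are the special case `ε`-part unused.
-/

namespace Summit.Parity.BatemanHorn.Theorems

open Finset Polynomial

/-! ### The second-moment profile -/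

/-- **The second-moment profile** with exponents `(θ, η)`:
`∃ C ∀ ε > 0 ∃ E₀ ∀ E ≥ E₀, 1 ≤ E ≤ E' ≤ 2E, H ≤ E^θ:
∑_{1≤h≤H} (‖T(h)‖² + ‖T(−h)‖²) ≤ ε·E²/H + C·H·E^{2(1−η)}` (`T(h) = ∑_{E<e≤E'} S_g(h;e)`). [this work] -/
def HooleyMeanSquareProfile (g : ℤ[X]) (θ η : ℝ) : Prop :=
  ∃ C : ℝ, ∀ ε : ℝ, 0 < ε → ∃ E₀ : ℕ, ∀ E E' H : ℕ, E₀ ≤ E → 1 ≤ E → E ≤ E' → E' ≤ 2 * E →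
    (H : ℝ) ≤ (E : ℝ) ^ θ →
      ∑ h ∈ Icc 1 H,
          (‖∑ e ∈ Ioc E E', hooleySum g e h‖ ^ 2 + ‖∑ e ∈ Ioc E E', hooleySum g e (-(h : ℤ))‖ ^ 2)
        ≤ ε * (E : ℝ) ^ 2 / H + C * H * (E : ℝ) ^ (2 * (1 - η))

/-- The constant may be taken nonnegative. [this work] -/
theorem HooleyMeanSquareProfile.exists_nonneg {g : ℤ[X]} {θ η : ℝ} (hyp : HooleyMeanSquareProfile g θ η) :
    ∃ C : ℝ, 0 ≤ C ∧ ∀ ε : ℝ, 0 < ε → ∃ E₀ : ℕ, ∀ E E' H : ℕ, E₀ ≤ E → 1 ≤ E → E ≤ E' → E' ≤ 2 * E →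
      (H : ℝ) ≤ (E : ℝ) ^ θ →
        ∑ h ∈ Icc 1 H,
            (‖∑ e ∈ Ioc E E', hooleySum g e h‖ ^ 2 + ‖∑ e ∈ Ioc E E', hooleySum g e (-(h : ℤ))‖ ^ 2)
          ≤ ε * (E : ℝ) ^ 2 / H + C * H * (E : ℝ) ^ (2 * (1 - η)) := by
  obtain ⟨C, hC⟩ := hyp
  refine ⟨max C 0, le_max_right _ _, fun ε hε => ?_⟩
  obtain ⟨E₀, hE₀⟩ := hC ε hε
  refine ⟨E₀, fun E E' H h0 hE hEE' hE' hH => (hE₀ E E' H h0 hE hEE' hE' hH).trans ?_⟩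
  have : 0 ≤ (H : ℝ) * (E : ℝ) ^ (2 * (1 - η)) := by positivity
  nlinarith [le_max_left C 0]

/-- The local mean-square hypothesis is the profile with the `ε`-part unused:
`HooleyMeanSquareLocal g θ η → HooleyMeanSquareProfile g θ η`. [this work] -/
theorem HooleyMeanSquareLocal.squareProfile {g : ℤ[X]} {θ η : ℝ} (hyp : HooleyMeanSquareLocal g θ η) :
    HooleyMeanSquareProfile g θ η := by
  obtain ⟨C, hC⟩ := hyp
  refine ⟨C, fun ε hε => ⟨0, fun E E' H _ hE hEE' hE' hH => (hC E E' H hE hEE' hE' hH).trans ?_⟩⟩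
  have : 0 ≤ ε * (E : ℝ) ^ 2 / H := by positivity
  linarith

/-- **Second-moment profile ⇒ `ℓ¹` profile** (Cauchy–Schwarz; constant `√(2C)`, `ε ↦ ε²/2`):
`HooleyMeanSquareProfile g θ η → HooleyMeanProfile g θ η`. [this work] -/
theorem HooleyMeanSquareProfile.meanProfile {g : ℤ[X]} {θ η : ℝ} (hyp : HooleyMeanSquareProfile g θ η) :
    HooleyMeanProfile g θ η := by
  obtain ⟨C, hC0, hC⟩ := hyp.exists_nonneg
  refine ⟨Real.sqrt (2 * C), fun ε hε => ?_⟩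
  obtain ⟨E₀, hE₀⟩ := hC (ε ^ 2 / 2) (by positivity)
  refine ⟨E₀, fun E E' H h0 hE hEE' hE' hH => ?_⟩
  have hS0 : 0 ≤ ∑ k ∈ Icc 1 H,
      (‖∑ e ∈ Ioc E E', hooleySum g e k‖ + ‖∑ e ∈ Ioc E E', hooleySum g e (-(k : ℤ))‖) :=
    sum_nonneg fun k _ => by positivity
  have hE0 : (0 : ℝ) ≤ (E : ℝ) := by positivity
  have hR0 : 0 ≤ ε * E + Real.sqrt (2 * C) * H * (E : ℝ) ^ (1 - η) := by positivity
  rcases Nat.eq_zero_or_pos H with rfl | hHpos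
  · simp only [Nat.cast_zero, mul_zero, zero_mul, add_zero]
    rw [show Icc 1 0 = (∅ : Finset ℕ) by rfl, sum_empty]; positivity
  have key := hE₀ E E' H h0 hE hEE' hE' hH
  have hsq := sq_sum_add_le_of_sum_sq_le (s := Icc 1 H)
    (a := fun k : ℕ => ‖∑ e ∈ Ioc E E', hooleySum g e k‖)
    (b := fun k : ℕ => ‖∑ e ∈ Ioc E E', hooleySum g e (-(k : ℤ))‖) key
  have hcard : ((Icc 1 H).card : ℝ) = H := by
    rw [Nat.card_Icc]; push_cast; ring
  rw [hcard] at hsq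
  have hHr : (0 : ℝ) < H := by exact_mod_cast hHpos
  have hpow : (E : ℝ) ^ (2 * (1 - η)) = ((E : ℝ) ^ (1 - η)) ^ 2 := by
    rw [← Real.rpow_natCast ((E : ℝ) ^ (1 - η)) 2, ← Real.rpow_mul hE0]
    push_cast; ring_nf
  have h2C : Real.sqrt (2 * C) ^ 2 = 2 * C := Real.sq_sqrt (by positivity)
  have htarget : (∑ k ∈ Icc 1 H,
      (‖∑ e ∈ Ioc E E', hooleySum g e k‖ + ‖∑ e ∈ Ioc E E', hooleySum g e (-(k : ℤ))‖)) ^ 2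
        ≤ (ε * E + Real.sqrt (2 * C) * H * (E : ℝ) ^ (1 - η)) ^ 2 := by
    have h1 : 2 * (H : ℝ) * (ε ^ 2 / 2 * (E : ℝ) ^ 2 / H + C * H * (E : ℝ) ^ (2 * (1 - η)))
        = (ε * E) ^ 2 + (Real.sqrt (2 * C) * H * (E : ℝ) ^ (1 - η)) ^ 2 := by
      rw [hpow, mul_pow, mul_pow, mul_pow, h2C]; field_simp
    have hcross : 0 ≤ 2 * (ε * E) * (Real.sqrt (2 * C) * H * (E : ℝ) ^ (1 - η)) := by positivity
    calc _ ≤ 2 * (H : ℝ) * (ε ^ 2 / 2 * (E : ℝ) ^ 2 / H + C * H * (E : ℝ) ^ (2 * (1 - η))) := hsq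
      _ = (ε * E) ^ 2 + (Real.sqrt (2 * C) * H * (E : ℝ) ^ (1 - η)) ^ 2 := h1
      _ ≤ (ε * E + Real.sqrt (2 * C) * H * (E : ℝ) ^ (1 - η)) ^ 2 := by nlinarith
  exact (pow_le_pow_iff_left₀ hS0 hR0 two_ne_zero).mp htarget

/-- **Erdős's asymptotics from the second-moment profile**: `g` irreducible of degree `d ≥ 3`,
`2 − 4/d < θ ≤ 1`, `η > 1 − 2/d`: `HooleyMeanSquareProfile g θ η → ErdosDivisorSumAsymptotic g`. [this work] -/
theorem erdosDivisorSumAsymptotic_of_meanSquareProfile {g : ℤ[X]} (hirr : Irreducible g)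
    (hdeg : 3 ≤ g.natDegree) {θ η : ℝ} (hθ : 2 - 4 / (g.natDegree : ℝ) < θ) (hθ1 : θ ≤ 1)
    (hη : 1 - 2 / (g.natDegree : ℝ) < η) (hyp : HooleyMeanSquareProfile g θ η) :
    ErdosDivisorSumAsymptotic g :=
  erdosDivisorSumAsymptotic_of_hooleyMeanProfile hirr hdeg hθ hθ1 hη hyp.meanProfile

/-! ### The pair-correlation profile -/

/-- **The pair-correlation profile** with exponents `(θ, η)`: on every dyadic range of moduli `(E, E']` with
`E ≥ E₀(ε)` and every scale `1/H`, `H ≤ 2E^θ`: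
`rootPairSum g E E' H ≤ N² + ε·E²/H + C·H·E^{2(1−η)}` — the Fejér-smoothed count of ordered pairs of root fractions
`ν/e, ν'/e'` at distance `≲ 1/H` exceeds the uniform prediction `N²` (`N = ∑_{E<e≤E'} ρ_g(e)`) by at most
`o(E²/H)` plus `C·H·E^{2(1−η)}` (Poissonian size of the excess: `N(H−1) ≍ H·E`, i.e. `η = 1/2`). [this work] -/
def HooleyPairCorrelationProfile (g : ℤ[X]) (θ η : ℝ) : Prop :=
  ∃ C : ℝ, ∀ ε : ℝ, 0 < ε → ∃ E₀ : ℕ, ∀ E E' H : ℕ, E₀ ≤ E → 1 ≤ E → E ≤ E' → E' ≤ 2 * E →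
    (H : ℝ) ≤ 2 * (E : ℝ) ^ θ →
      rootPairSum g E E' H ≤
        (#(rootPoints g E E') : ℝ) ^ 2 + ε * (E : ℝ) ^ 2 / H + C * H * (E : ℝ) ^ (2 * (1 - η))

/-- The local pair-correlation hypothesis is the profile with the `ε`-part unused. [this work] -/
theorem HooleyPairCorrelationLocal.pairProfile {g : ℤ[X]} {θ η : ℝ} (hyp : HooleyPairCorrelationLocal g θ η) :
    HooleyPairCorrelationProfile g θ η := by
  obtain ⟨C, hC⟩ := hyp
  refine ⟨C, fun ε hε => ⟨0, fun E E' H _ hE hEE' hE' hH => (hC E E' H hE hEE' hE' hH).trans ?_⟩⟩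
  have : 0 ≤ ε * (E : ℝ) ^ 2 / H := by positivity
  linarith

/-- **Pair-correlation profile ⇒ second-moment profile** (same exponents, constant `4C`, same `ε`). [this work] -/
theorem HooleyPairCorrelationProfile.squareProfile {g : ℤ[X]} {θ η : ℝ}
    (hyp : HooleyPairCorrelationProfile g θ η) : HooleyMeanSquareProfile g θ η := by
  obtain ⟨C, hC⟩ := hyp
  refine ⟨4 * C, fun ε hε => ?_⟩
  obtain ⟨E₀, hE₀⟩ := hC ε hε
  refine ⟨E₀, fun E E' H h0 hE hEE' hE' hH => ?_⟩
  rcases Nat.eq_zero_or_pos H with rfl | hHpos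
  · simp
  have h2H : ((2 * H : ℕ) : ℝ) ≤ 2 * (E : ℝ) ^ θ := by push_cast; linarith
  have hP := hE₀ E E' (2 * H) h0 hE hEE' hE' h2H
  have hHr : (0 : ℝ) < H := by exact_mod_cast hHpos
  have hdiv : ε * (E : ℝ) ^ 2 / ((2 * H : ℕ) : ℝ) = (ε * (E : ℝ) ^ 2 / H) / 2 := by
    push_cast; field_simp
  calc ∑ h ∈ Icc 1 H, (‖∑ e ∈ Ioc E E', hooleySum g e h‖ ^ 2 +
          ‖∑ e ∈ Ioc E E', hooleySum g e (-(h : ℤ))‖ ^ 2)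
      ≤ 2 * (rootPairSum g E E' (2 * H) - (#(rootPoints g E E') : ℝ) ^ 2) := sum_Icc_norm_sq_le g E E' hHpos
    _ ≤ 2 * (ε * (E : ℝ) ^ 2 / ((2 * H : ℕ) : ℝ) + C * ((2 * H : ℕ) : ℝ) * (E : ℝ) ^ (2 * (1 - η))) := by
        linarith
    _ = ε * (E : ℝ) ^ 2 / H + 4 * C * H * (E : ℝ) ^ (2 * (1 - η)) := by
        rw [hdiv]; push_cast; ring

/-- **Second-moment profile ⇒ pair-correlation profile** for `H ≤ E^θ` (same constant and `ε`): with
`HooleyPairCorrelationProfile.squareProfile` the two profiles are equivalent up to the factor `2` in the admissible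
range of scales. [this work] -/
theorem HooleyMeanSquareProfile.rootPairSum_le {g : ℤ[X]} {θ η : ℝ} (hyp : HooleyMeanSquareProfile g θ η) :
    ∃ C : ℝ, ∀ ε : ℝ, 0 < ε → ∃ E₀ : ℕ, ∀ E E' H : ℕ, E₀ ≤ E → 1 ≤ E → E ≤ E' → E' ≤ 2 * E →
      (H : ℝ) ≤ (E : ℝ) ^ θ →
        rootPairSum g E E' H ≤
          (#(rootPoints g E E') : ℝ) ^ 2 + ε * (E : ℝ) ^ 2 / H + C * H * (E : ℝ) ^ (2 * (1 - η)) := by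
  obtain ⟨C, hC⟩ := hyp
  refine ⟨C, fun ε hε => ?_⟩
  obtain ⟨E₀, hE₀⟩ := hC ε hε
  refine ⟨E₀, fun E E' H h0 hE hEE' hE' hH => ?_⟩
  have h1 := rootPairSum_sub_sq_le g E E' H
  have h2 := hE₀ E E' H h0 hE hEE' hE' hH
  linarith

/-- What the pair profile asks at the coarsest scale (through the sandwich at `H = 1`, i.e. `PS(2)`):
`|T(1)|² + |T(−1)|² ≤ ε·E² + C'·E^{2(1−η)}` for every `ε > 0` and `E ≥ E₀(ε)` — qualitative equidistribution of
the root fractions over dyadic blocks (known: Hooley 1964), no pointwise power saving. [this work] -/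
theorem HooleyPairCorrelationProfile.freq_one {g : ℤ[X]} {θ η : ℝ} (hθ : 0 ≤ θ)
    (hyp : HooleyPairCorrelationProfile g θ η) :
    ∃ C : ℝ, ∀ ε : ℝ, 0 < ε → ∃ E₀ : ℕ, ∀ E E' : ℕ, E₀ ≤ E → 1 ≤ E → E ≤ E' → E' ≤ 2 * E →
      ‖∑ e ∈ Ioc E E', hooleySum g e 1‖ ^ 2 + ‖∑ e ∈ Ioc E E', hooleySum g e (-1)‖ ^ 2
        ≤ ε * (E : ℝ) ^ 2 + C * (E : ℝ) ^ (2 * (1 - η)) := by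
  obtain ⟨C, hC⟩ := hyp.squareProfile
  refine ⟨C, fun ε hε => ?_⟩
  obtain ⟨E₀, hE₀⟩ := hC ε hε
  refine ⟨E₀, fun E E' h0 hE hEE' hE' => ?_⟩
  have hH : ((1 : ℕ) : ℝ) ≤ (E : ℝ) ^ θ := by
    rw [Nat.cast_one]
    exact Real.one_le_rpow (by exact_mod_cast hE) hθ
  have key := hE₀ E E' 1 h0 hE hEE' hE' hH
  simpa using key

/-- **Erdős's asymptotic for cubics from the pair-correlation profile.**  For an irreducible cubic `g`, if for
some `θ > 2/3` (`θ ≤ 1`) and `η > 1/3` the Fejér pair sums of the root fractions satisfy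
`PS(H) ≤ N² + ε·E²/H + C·H·E^{2(1−η)}` for every `ε > 0`, `E ≥ E₀(ε)`, `E ≤ E' ≤ 2E`, `H ≤ 2E^θ`, then
`∑_{n≤x} τ(g(n)) ~ 3·A_g·x log x`. [this work] -/
theorem erdosDivisorSumAsymptotic_cubic_of_pairCorrelationProfile {g : ℤ[X]} (hirr : Irreducible g)
    (hdeg : g.natDegree = 3) {θ η : ℝ} (hθ : 2 / 3 < θ) (hθ1 : θ ≤ 1) (hη : 1 / 3 < η)
    (hyp : HooleyPairCorrelationProfile g θ η) : ErdosDivisorSumAsymptotic g :=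
  erdosDivisorSumAsymptotic_cubic_of_hooleyMeanProfile hirr hdeg hθ hθ1 hη hyp.squareProfile.meanProfile

end Summit.Parity.BatemanHorn.Theorems
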